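import Mathlib
import HarnessLib
import Summits.ValiantsHypothesis.ValiantsHypothesis.Theses.ValuativeGCT
import Literature.Computability.Complexity.OccurrenceObstructionsIPProofs

/-!
# IdeatorOneSketch — first lemmas of two crux ideas for `ValuativeGCT.TailFlip`
(stmt-ValiantsHypothesis-15687; crux-ideate round 1, ideator 1).  Statements (Props) plus one
small sorry-free engine lemma; nothing here is an item.

* Card `support-independent-inheritance`: `SupportIndependentInheritance` (first lemma: on
  support-independent inner points the padding twist is a torus element, so untwisted evaluation
  certificates hold at every padding), `TorusInterpolation` (its torus step),
  `det_sum_smul_ne_zero_of_signRigid` (abstract engine of the sign-rigid EXTENSION, proved) and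
  `SignRigidInheritance` (the extension to dependent supports with sign-coherent survivors).
* Card `mixed-discriminant-dictionary`: `MixedDiscriminantFreeness` (Procesi: no trace identity of
  degree ≤ m), `NoSmallBodyEquations` (K_m(λ*) = a_λ(δ[m]) whenever |λ̄| ≤ m), `NoSmallBodyFlip`
  (hence no valuative flip at body ≤ m, for every centre).
-/

set_option linter.dupNamespace false

namespace Summit.ValiantsHypothesis.ValiantsHypothesis.Cruxes.TailFlip.IdeatorOneSketch

open scoped BigOperators Matrix
open Literature.NumberTheory.DiophantineGeometry Literature.Computability.AlgebraicComplexity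
open Literature.Computability.Complexity

/-! ## Card 1 — sign-rigid certificates -/

/-- ABSTRACT ENGINE (proved): a positively weighted sum of real matrices that are all lower
triangular, with non-negative diagonals and, in every diagonal position, at least one strictly
positive contribution, is nonsingular.  Applied with `t` = the monomials of a highest-weight vector,
`w t` = the padding twist `∏_e ((e_top + j)!/e_top!)^{d e}` (positive for every padding `j`) and
`M t` = the signed coefficient products at `0/1` endomorphism points, it makes an evaluation
certificate of the permanent hold at EVERY padding at once. [folklore] -/
theorem det_sum_smul_ne_zero_of_signRigid {D : ℕ} {ι : Type*} (s : Finset ι) (w : ι → ℝ)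
    (M : ι → Matrix (Fin D) (Fin D) ℝ)
    (hw : ∀ t ∈ s, 0 < w t)
    (hupper : ∀ t ∈ s, ∀ i l : Fin D, i < l → M t i l = 0)
    (hnonneg : ∀ t ∈ s, ∀ i : Fin D, 0 ≤ M t i i)
    (hpos : ∀ i : Fin D, ∃ t ∈ s, 0 < M t i i) :
    (∑ t ∈ s, w t • M t).det ≠ 0 := by
  classical
  have hentry : ∀ i l, (∑ t ∈ s, w t • M t) i l = ∑ t ∈ s, w t * M t i l := by
    intro i l
    simp [Matrix.sum_apply, Matrix.smul_apply, smul_eq_mul]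
  have htri : (∑ t ∈ s, w t • M t).BlockTriangular OrderDual.toDual := by
    intro i l hil
    rw [hentry]
    refine Finset.sum_eq_zero fun t ht => ?_
    have hil' : i < l := by simpa using hil
    rw [hupper t ht i l hil', mul_zero]
  rw [Matrix.det_of_lowerTriangular _ htri]
  refine Finset.prod_ne_zero_iff.mpr fun i _ => ?_
  rw [hentry]
  obtain ⟨t₀, ht₀, hpos₀⟩ := hpos i
  exact (Finset.sum_pos' (fun t ht => mul_nonneg (hw t ht).le (hnonneg t ht i))
    ⟨t₀, ht₀, mul_pos (hw t₀ ht₀) hpos₀⟩).ne'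

/-- FIRST LEMMA of card `sign-rigid-certificates` (SIGN-RIGID INHERITANCE; provable now from the
landed `Theorems.ValuativeFlip.stub_twistedInheritance` + the engine above).  Inner size `n`,
degree `δ`, inner shape `μ ⊢ nδ` (≤ n² parts); REAL highest-weight vectors `F_i` of weight `μ*`
(integer tableau functions qualify) and entrywise NON-NEGATIVE endomorphisms `A_l` (0/1 graph
projections, all-ones + permutation directions, …), so that every coefficient
`c_e(A_l · per_n) ≥ 0`.  Call a monomial `d` of `F_i` SURVIVING at `A_l` when every coefficient
variable it uses is nonzero at `A_l · per_n`.  If survivors are structurally absent above the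
diagonal (`i < l`) and carry positive coefficients on the diagonal (at least one each), then the
Δ_j-twisted evaluation matrix is lower triangular with positive diagonal for EVERY padding `j`
(the twist only rescales each monomial by a positive factor), hence
`D ≤ mult_{(μ♯(n+j))*} ℂ[Δ_{n+j}(X₀₀^j per_n)]` for all `j ≥ 0` simultaneously: padding-EXACT
inheritance of positive certificates (the provable substitute for BLMW Problem 6.10 on the
certificates the tail needs). -/
def SignRigidInheritance : Prop :=
  ∀ (n δ : ℕ) [NeZero n] (μ : Nat.Partition (n * δ)), μ.parts.card ≤ n * n →
    ∀ (D : ℕ) (F : Fin D → MvPolynomial (DegIdx (MatIdx n) n) ℝ)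
      (A : Fin D → Matrix (MatIdx n) (MatIdx n) ℝ),
      (∀ i, MvPolynomial.map (algebraMap ℝ ℂ) (F i) ∈
          highestWeightSpace (coordRep (MatIdx n) ℂ n) (partitionWeightLex n μ)) →
      (∀ l a b, 0 ≤ A l a b) →
      (let c : Fin D → DegIdx (MatIdx n) n → ℝ := fun l e =>
          MvPolynomial.coeff e.1 (linSubst (MatIdx n) ℝ (A l) (paddedPerFormLex ℝ n n))
       let Surv : Fin D → Fin D → ((DegIdx (MatIdx n) n) →₀ ℕ) → Prop := fun i l d =>
          d ∈ (F i).support ∧ ∀ e ∈ d.support, c l e ≠ 0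
       (∀ i l d, i < l → ¬ Surv i l d) ∧
       (∀ i d, Surv i i d → 0 < MvPolynomial.coeff d (F i)) ∧
       (∀ i, ∃ d, Surv i i d)) →
      ∀ (j : ℕ) [NeZero (n + j)],
        D ≤ orbitMultiplicity ℂ (paddedPerFormLex ℂ n (n + j)) (n + j)
          (partitionWeightLex (n + j) (rowLift μ j))

/-- FIRST LEMMA of card `support-independent-inheritance` (provable now, ~30 lines over the landed
`Theorems.ValuativeFlip.stub_twistedInheritance`).  THE OBSERVATION: at an inner point
`f_l = A_l · per_n` whose monomial SUPPORT is a linearly independent set of exponent vectors, the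
padding twist `Δ_j` (coefficient of `x^e` rescaled by `(e_top + j)!/e_top! > 0`) agrees on
`supp f_l` with a diagonal TORUS element `t(l, j) ∈ (ℂ×)^{n²}` (solve `⟨e, log t⟩ = log w_j(e_top)`
on the independent support), so `Δ_j f_l = t · f_l` is again a point of the orbit of `f_l`, and a
highest-weight vector of weight `μ*` takes the value `F(Δ_j f_l) = t^{∓μ*} F(f_l)`: the twisted
evaluation matrix is the untwisted one with its COLUMNS rescaled by nonzero scalars.  Hence an
ordinary (untwisted) evaluation certificate on support-independent points holds at EVERY padding:
BLMW Problem 6.10 is true for the part of the multiplicity visible at such points, and the tail's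
per side becomes the padding-free inner quantity
`P_n^ind(μ) := rank of HWV_{μ*} on support-independent End-points of per_n`. -/
def SupportIndependentInheritance : Prop :=
  ∀ (n δ : ℕ) [NeZero n] (μ : Nat.Partition (n * δ)), μ.parts.card ≤ n * n →
    ∀ (D : ℕ) (F : Fin D → MvPolynomial (DegIdx (MatIdx n) n) ℂ)
      (A : Fin D → Matrix (MatIdx n) (MatIdx n) ℂ),
      (∀ i, F i ∈ highestWeightSpace (coordRep (MatIdx n) ℂ n) (partitionWeightLex n μ)) →
      (∀ l, LinearIndependent ℚ
          (fun e : ↥(linSubst (MatIdx n) ℂ (A l) (paddedPerFormLex ℂ n n)).support =>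
            fun i : MatIdx n => ((e.1 i : ℕ) : ℚ))) →
      (Matrix.of fun i l : Fin D =>
          MvPolynomial.aeval (formCoeff n (linSubst (MatIdx n) ℂ (A l) (paddedPerFormLex ℂ n n)))
            (F i)).det ≠ 0 →
      ∀ (j : ℕ) [NeZero (n + j)],
        D ≤ orbitMultiplicity ℂ (paddedPerFormLex ℂ n (n + j)) (n + j)
          (partitionWeightLex (n + j) (rowLift μ j))

/-- The torus step in isolation (provable now): on a linearly independent finite set `S` of
exponent vectors every positive weight function is interpolated by a diagonal torus character,
`∃ t : σ → ℝ, (∀ i, 0 < t i) ∧ ∀ e ∈ S, ∏ i, t i ^ e i = w e`. [folklore] -/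
def TorusInterpolation : Prop :=
  ∀ {σ : Type} [Fintype σ] [DecidableEq σ] (S : Finset (σ →₀ ℕ)) (w : (σ →₀ ℕ) → ℝ),
    (∀ e ∈ S, 0 < w e) →
    LinearIndependent ℚ (fun e : ↥S => fun i : σ => ((e.1 i : ℕ) : ℚ)) →
    ∃ t : σ → ℝ, (∀ i, 0 < t i) ∧ ∀ e ∈ S, ∏ i, t i ^ (e i) = w e

/-! ## Card 2 — the mixed-discriminant / trace-identity dictionary -/

/-- MIXED-DISCRIMINANT FREENESS (Procesi 1976: the pure trace ring of `m × m` matrices has no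
identities of degree `≤ m`), in the coordinates the dictionary uses.  The mixed discriminants
`disc_γ = [x^γ] det(∑_{i=0}^{s} x_i V_i)` of `s+1` generic `m × m` matrices (entries = free
variables), weighted by the JET ORDER `m - γ₀` (the part of the content away from the base matrix
`V₀ = X`), satisfy no polynomial relation of weighted degree `≤ m`.  (Proof sketch: divide by
`det X`; `[x^γ] det(1 + ∑ y_i Y_i)`, `Y_i = X⁻¹ V_i`, is an invertible weighted transform of
`L_γ = ± |γ|⁻¹ ∑_{words of content γ} tr(Y_w)`, distinct `γ` use disjoint sets of free trace
generators, and a relation of weighted degree `≤ m` would be a trace identity of degree `≤ m`.) -/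
def MixedDiscriminantFreeness : Prop :=
  ∀ (m s : ℕ),
    let R := MvPolynomial (Fin (s + 1) × Fin m × Fin m) ℂ
    let P : Matrix (Fin m) (Fin m) (MvPolynomial (Fin (s + 1)) R) :=
      Matrix.of fun a b => ∑ i : Fin (s + 1),
        MvPolynomial.C (MvPolynomial.X (R := ℂ) (i, a, b)) * MvPolynomial.X i
    let disc : {γ : Fin (s + 1) →₀ ℕ // γ.degree = m} → R := fun γ => MvPolynomial.coeff γ.1 P.det
    ∀ Q : MvPolynomial {γ : Fin (s + 1) →₀ ℕ // γ.degree = m} ℂ,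
      MvPolynomial.weightedTotalDegree
          (fun γ : {γ : Fin (s + 1) →₀ ℕ // γ.degree = m} => m - γ.1 0) Q ≤ m →
      MvPolynomial.aeval disc Q = 0 → Q = 0

/-- NO SMALL-BODY EQUATIONS (first lemma of card `mixed-discriminant-dictionary`; consequence of
`MixedDiscriminantFreeness` through the dictionary "type-λ highest-weight vectors with `ℓ(λ) = s+1`
read only the affine `|λ̄|`-jet in `s` directions = polynomials of weighted degree `|λ̄|` in the
mixed discriminants"): if the body `|λ̄| = mδ - λ₁` is at most `m`, the determinant orbit closure
has NO equation of type `λ`, i.e. its multiplicity is the full plethysm coefficient.  Landed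
neighbours: `orbitMultiplicity_le_plethysmCoeff_holds` (≤ always), IP17 Prop. 2.8 / StableRay
(`a_λ ≤ g` on the same range, Kronecker flips only). -/
def NoSmallBodyEquations : Prop :=
  ∀ (m δ : ℕ) [NeZero m] (lam : Nat.Partition (m * δ)), lam.parts.card ≤ m * m →
    bodySize lam ≤ m →
    orbitMultiplicity ℂ (detFormLex ℂ m) m (partitionWeightLex m lam) =
      plethysmCoeff ℂ (MatIdx m) m (partitionWeightLex m lam)

/-- NO SMALL-BODY FLIP, in the crux's own currency (from `NoSmallBodyEquations`, the proved
`ValuativeBound` `K_m ≤ dim T_U` and `mult_pp ≤ a_λ`): at body `≤ m` no admissible centre `(U, r)`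
flips.  Consequence for `TailFlip` witnesses (with Kadish–Landsberg `λ₁ ≥ δ(m-n)`, landed):
`m < |λ̄| ≤ nδ`, i.e. the degree of every witness satisfies `δ > m/n` at every tail position. -/
def NoSmallBodyFlip : Prop :=
  ∀ (n m : ℕ) [NeZero m], n ≤ m →
    ∀ (U : Submodule ℂ (MatIdx m → ℂ)) (r δ : ℕ) (lam : Nat.Partition (m * δ)),
      (∀ u ∈ U, (Matrix.of fun a b : Fin m => u (toLex (a, b))).rank ≤ r) →
      lam.parts.card ≤ m * m → bodySize lam ≤ m →
      let χ : Weight (MatIdx m) := (Weight.dualOfPartition (m * m) lam).toMatIdx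
      let T : Submodule ℂ (MvPolynomial (MatIdx m × MatIdx m) ℂ) :=
        MvPolynomial.homogeneousSubmodule (MatIdx m × MatIdx m) ℂ (m * δ) ⊓
        ((MvPolynomial.vanishingIdeal ℂ
            {p : MatIdx m × MatIdx m → ℂ | ∀ j : MatIdx m, (fun i => p (j, i)) ∈ U}) ^
              (δ * (m - r))).restrictScalars ℂ ⊓
        (⨅ (M : Matrix (MatIdx m) (MatIdx m) ℂ)
            (_ : linSubst (MatIdx m) ℂ M (detFormLex ℂ m) = detFormLex ℂ m),
            LinearMap.ker ((MvPolynomial.aeval (R := ℂ) fun p : MatIdx m × MatIdx m =>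
                ∑ l : MatIdx m, M l p.2 • MvPolynomial.X (p.1, l)).toLinearMap -
              LinearMap.id (R := ℂ) (M := MvPolynomial (MatIdx m × MatIdx m) ℂ))) ⊓
        (⨅ (g : Matrix.GeneralLinearGroup (MatIdx m) ℂ) (_ : IsUpperTriangular g),
            LinearMap.ker ((MvPolynomial.aeval (R := ℂ) fun p : MatIdx m × MatIdx m =>
                ∑ l : MatIdx m, ((g⁻¹ : Matrix.GeneralLinearGroup (MatIdx m) ℂ) :
                  Matrix (MatIdx m) (MatIdx m) ℂ) p.1 l • MvPolynomial.X (l, p.2)).toLinearMap -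
              weightChar χ g • LinearMap.id (R := ℂ) (M := MvPolynomial (MatIdx m × MatIdx m) ℂ)))
      orbitMultiplicity ℂ (paddedPerFormLex ℂ n m) m χ ≤ Module.finrank ℂ ↥T

/-- Bookkeeping check (sorry-free): the crux's degree constraint.  If a witness shape `λ ⊢ mδ`
has first part `≥ δ (m - n)` (Kadish–Landsberg, landed `kadishLandsberg_of_hasHighestWeight_…`)
and body `> m` (forced by `NoSmallBodyFlip`), then `m < n * δ`. [folklore] -/
theorem degree_exceeds_padding_ratio {n m δ a N : ℕ} (hnm : n ≤ m) (hN : N = m * δ)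
    (ha : a ≤ N) (hKL : δ * (m - n) ≤ a) (hbody : m < N - a) : m < n * δ := by
  subst hN
  have key : δ * (m - n) + δ * n = δ * m := by rw [← Nat.mul_add, Nat.sub_add_cancel hnm]
  rw [Nat.mul_comm n δ]
  rw [Nat.mul_comm m δ] at ha hbody
  generalize δ * (m - n) = x at hKL key
  generalize δ * n = y at key ⊢
  generalize δ * m = z at key ha hbody
  omega

end Summit.ValiantsHypothesis.ValiantsHypothesis.Cruxes.TailFlip.IdeatorOneSketch
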